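import Literature.AlgebraicGeometry.Resolution.AbhyankarToroidalChartsProofs
import Literature.AlgebraicGeometry.Resolution.AbhyankarSimplePoints
import Literature.AlgebraicGeometry.Resolution.AbhyankarBases
import HarnessLib

/-!
# Toric charts along a finite extension and finite subcharts (Temkin 2013, proof of Thm. 5.5.2)

Topic: `Literature/AlgebraicGeometry/Resolution`. M. Temkin, *Inseparable local uniformization*,
J. Algebra 373 (2013) 65–119 = arXiv:0804.1554v3 (numbers and pages of this version). In the proof
of Thm. 5.5.2 (pp. 60–61) ONE Abhyankar basis `B ⊂ K` and ONE toric monoid serve both the valued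
field `K` and its finite extension `K₁` ("Notice that `B` is an Abhyankar basis of each `Kᵢ` …
find a sufficiently large toric monoid `M ⊂ |K_B°|` which matches `B`, `K` and all `Kᵢ`'s …
`Xᵢ = Nr_{Kᵢ}(A_{B,M})`"), the monoid living in the value group of `K₁` and being cut back to
`K` (`M_B = M ∩ Λ_B`). This file PROVES the bookkeeping this requires, in the vocabulary of
`AbhyankarToroidalCharts.lean`:

* `valMem_comap_iff`, `comap_le_valuationMonoid` — values in `M ⊆ |K₁^×|` versus values in its
  preimage `M ∩ |K^×|` under the embedding `|K^×| → |K₁^×|` (`unitsValueGroupHom`,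
  `GeneralizedStability.lean`);
* `map_toricChart_comap_le` — the chart `k[M_B] ⊆ K` of `B` and `M ∩ |K^×|` maps into the chart
  `k[M_B] ⊆ K₁` of the same basis `B ⊂ K₁` and `M`;
* `exists_finite_subchart` — **finite subcharts**: for a finitely generated `M = ⟨b₁, …, b_n⟩`
  the normalization `Nr(k[M_B])` is already the normalization of the FINITE chart
  `k[y^{±1}, x^{e₁}, …, x^{e_n}]`, where `x^{eᵢ}` is a Laurent monomial of value `bᵢ^N` (some power
  of every value lies in `Λ_B`): every monomial `x^d` of `k[M_B]` has `(x^d)^N ∈ k[x^{eᵢ}]`, so it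
  is integral over the finite chart. This replaces the finite generation of `k[M_B]` (a toric
  VARIETY, §5.3) in the construction of the refined affine model `X'` of `K°`.

## Source

* M. Temkin, *Inseparable local uniformization*, arXiv:0804.1554v3: §5.3 (p. 55: `Λ_B`,
  `M_B = M ∩ Λ_B`, `k[M_B]`), proof of Thm. 5.5.2 (pp. 60–61). The algebra is standard
  ([folklore]) given those definitions.
-/

noncomputable section

namespace Literature.AlgebraicGeometry.Resolution

open IsLocalRing ValuationSubring

universe u

/-! ### Values along `K → K₁` -/

section Values

variable {K K₁ : Type u} [Field K] [Field K₁] [Algebra K K₁] (O₁ : ValuationSubring K₁)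

/-- An element of `|K^×|` is `≤ 1` iff its image in `|K₁^×|` is. [folklore] -/
theorem unitsValueGroupHom_le_one_iff (γ : ((O₁.comap (algebraMap K K₁)).ValueGroup)ˣ) :
    ((unitsValueGroupHom K O₁ γ : (O₁.ValueGroup)ˣ) : O₁.ValueGroup) ≤ 1 ↔
      (γ : (O₁.comap (algebraMap K K₁)).ValueGroup) ≤ 1 := by
  have h1 : valueGroupHom K O₁ 1 = 1 := map_one _
  change valueGroupHom K O₁ (γ : (O₁.comap (algebraMap K K₁)).ValueGroup) ≤ 1 ↔ _
  conv_lhs => rw [← h1]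
  exact valueGroupHom_le_iff K O₁ _ _

/-- The preimage in `|K^×|` of a monoid `M ⊆ Λ₁° = |K₁° ∖ 0|` lies in `Λ° = |K° ∖ 0|`. [folklore] -/
theorem comap_le_valuationMonoid {M : Submonoid (O₁.ValueGroup)ˣ} (hM : M ≤ valuationMonoid O₁) :
    M.comap (unitsValueGroupHom K O₁) ≤ valuationMonoid (O₁.comap (algebraMap K K₁)) :=
  fun γ hγ => (mem_valuationMonoid_iff _).mpr
    ((unitsValueGroupHom_le_one_iff O₁ γ).mp ((mem_valuationMonoid_iff _).mp (hM hγ)))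

/-- **"`|m| ∈ M ∩ |K^×|`" iff "`|m| ∈ M`" in `K₁`** for `m ∈ K`. [folklore] -/
theorem valMem_comap_iff (M : Submonoid (O₁.ValueGroup)ˣ) (m : K) :
    ValMem (O₁.comap (algebraMap K K₁)) (M.comap (unitsValueGroupHom K O₁)) m ↔
      ValMem O₁ M (algebraMap K K₁ m) := by
  constructor
  · rintro ⟨γ, hγ, hγm⟩
    refine ⟨unitsValueGroupHom K O₁ γ, hγ, ?_⟩
    change valueGroupHom K O₁ (γ : (O₁.comap (algebraMap K K₁)).ValueGroup) = _
    rw [hγm, valueGroupHom_valuation]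
  · rintro ⟨γ₁, hγ₁, hγ₁m⟩
    have hm : m ≠ 0 := by
      rintro rfl
      rw [map_zero, map_zero] at hγ₁m
      exact γ₁.ne_zero hγ₁m
    refine ⟨Units.mk0 ((O₁.comap (algebraMap K K₁)).valuation m)
      (valuation_ne_zero_of_ne_zero _ hm), ?_, rfl⟩
    change unitsValueGroupHom K O₁ _ ∈ M
    rw [unitsValueGroupHom_mk0]
    convert hγ₁
    exact Units.ext hγ₁m.symm

end Values

/-! ### Charts of one basis in `K` and in `K₁` -/

section Charts

variable {k K K₁ : Type u} [Field k] [Field K] [Field K₁] [Algebra k K] [Algebra K K₁]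
  [Algebra k K₁] [IsScalarTower k K K₁] (O₁ : ValuationSubring K₁)

/-- Laurent monomials commute with `K → K₁`. [folklore] -/
theorem algebraMap_lmonomial {κ : Type*} (x : κ → K) (d : κ →₀ ℤ) :
    algebraMap K K₁ (d.prod fun j (n : ℤ) => x j ^ n) =
      d.prod fun j (n : ℤ) => algebraMap K K₁ (x j) ^ n := by
  rw [map_finsuppProd]
  simp only [map_zpow₀]

/-- **The chart of `B ⊂ K` maps into the chart of `B ⊂ K₁`** for the same monoid `M ⊆ |K₁^×|`
(cut back to `|K^×|` on the `K`-side): `k[M_B]_K → k[M_B]_{K₁}` along `K → K₁`.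
[cite: Temkin2013, Section 5.3 (p. 55) and proof of Thm. 5.5.2 (p. 61)] -/
theorem map_toricChart_comap_le {κ ι : Type*} (x : κ → K) (y : ι → O₁.comap (algebraMap K K₁))
    (M : Submonoid (O₁.ValueGroup)ˣ) :
    (toricChart (k := k) (O₁.comap (algebraMap K K₁)) x y
        (M.comap (unitsValueGroupHom K O₁))).map (IsScalarTower.toAlgHom k K K₁) ≤
      toricChart (k := k) O₁ (fun j => algebraMap K K₁ (x j)) (fun i => comapInclusion O₁ (y i)) M := by
  rw [Subalgebra.map_le]
  refine Algebra.adjoin_le ?_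
  intro m hm'
  rw [SetLike.mem_coe, Subalgebra.mem_comap]
  change algebraMap K K₁ m ∈ toricChart (k := k) O₁ (fun j => algebraMap K K₁ (x j))
    (fun i => comapInclusion O₁ (y i)) M
  rcases hm' with (⟨i, rfl⟩ | ⟨i, rfl⟩) | ⟨hm, d, rfl⟩
  · exact coe_mem_toricChart (fun j => algebraMap K K₁ (x j)) (fun i => comapInclusion O₁ (y i)) M i
  · rw [map_inv₀]
    exact inv_coe_mem_toricChart (fun j => algebraMap K K₁ (x j))
      (fun i => comapInclusion O₁ (y i)) M i
  · have hval : ValMem O₁ M (algebraMap K K₁ (d.prod fun j (n : ℤ) => x j ^ n)) :=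
      (valMem_comap_iff O₁ M _).mp hm
    rw [algebraMap_lmonomial] at hval ⊢
    exact lmonomial_mem_toricChart (fun j => algebraMap K K₁ (x j))
      (fun i => comapInclusion O₁ (y i)) d hval

end Charts

/-! ### Normalizations and finite subcharts -/

section Subchart

variable {k L : Type u} [Field k] [Field L] [Algebra k L] (O : ValuationSubring L)
  (hk : ∀ c : k, algebraMap k L c ∈ O)

/-- `Nr(Nr(C)) = Nr(C)` (transitivity of integrality). [folklore] -/
theorem nrAlg_nrAlg (C : Subalgebra k L) : nrAlg (nrAlg C) = nrAlg C :=
  le_antisymm (fun _ hz => mem_nrAlg_of_isIntegral_nrAlg (mem_nrAlg_iff.mp hz)) (le_nrAlg _)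

/-- `C ≤ Nr(C') ⇒ Nr(C) ≤ Nr(C')`. [folklore] -/
theorem nrAlg_le_nrAlg_of_le_nrAlg {C C' : Subalgebra k L} (h : C ≤ nrAlg C') : nrAlg C ≤ nrAlg C' := by
  rw [← nrAlg_nrAlg C']
  exact nrAlg_mono h

/-- An element some positive power of which lies in `C` is in `Nr(C)`. [folklore] -/
theorem mem_nrAlg_of_pow_mem {C : Subalgebra k L} {z : L} {N : ℕ} (hN : 0 < N) (hz : z ^ N ∈ C) :
    z ∈ nrAlg C :=
  mem_nrAlg_iff.mpr (IsIntegral.of_pow hN (isIntegral_algebraMap (R := C) (x := ⟨z ^ N, hz⟩)))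

/-- **Finite subcharts.** Let `B = x ⊔ y` be an Abhyankar basis of the valued field `L` over the
trivially valued `k` and `M = ⟨b₁, …, b_n⟩ ⊆ Λ°` a finitely generated monoid of values `≤ 1`. Some
power `bᵢ^N` of each generator lies in `Λ_B` (`IsAbhyankarBasis.exists_pow_mem_closure`), i.e. is
the value of a Laurent monomial `x^{eᵢ}` — a monomial of `k[M_B]` —, and then EVERY monomial `x^d`
of `k[M_B]` satisfies `(x^d)^N ∈ k[x^{e₁}, …, x^{e_n}]` (`|x^d| = ∏ bᵢ^{cᵢ}` forces
`N d = ∑ cᵢ eᵢ`, the values of monomials being `ℤ`-independent). Hence the normalization of the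
toric chart `k[M_B]` in `L` equals the normalization of its finitely generated subalgebra
`k[y^{±1}, x^{e₁}, …, x^{e_n}]`. [cite: Temkin2013, Section 5.3 (p. 55) and proof of Thm. 5.5.2 (pp. 60–61)] -/
theorem exists_finite_subchart {E F : ℕ} {x : Fin E → L} {y : Fin F → O}
    (hB : IsAbhyankarBasis O hk x y) {n : ℕ} (b : Fin n → (ValueGroup O)ˣ) :
    ∃ e : Fin n → (Fin E →₀ ℤ),
      (∀ i, ValMem O (Submonoid.closure (Set.range b)) ((e i).prod fun j (n : ℤ) => x j ^ n)) ∧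
      nrAlg (toricChart (k := k) O x y (Submonoid.closure (Set.range b))) =
        nrAlg (Algebra.adjoin k ((Set.range fun i => (y i : L)) ∪ (Set.range fun i => (y i : L)⁻¹) ∪
          Set.range fun i => (e i).prod fun j (n : ℤ) => x j ^ n)) := by
  classical
  set M : Submonoid (ValueGroup O)ˣ := Submonoid.closure (Set.range b) with hM
  -- a common exponent `N > 0` with `bᵢ^N ∈ Λ_B`
  choose nb hnb hnbmem using fun i => hB.exists_pow_mem_closure (b i)
  set N : ℕ := ∏ i, nb i with hNdef
  have hN : 0 < N := Finset.prod_pos fun i _ => hnb i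
  have hbN : ∀ i, b i ^ N ∈ Subgroup.closure (Set.range fun j =>
      Units.mk0 (O.valuation (x j)) (valuation_ne_zero_of_ne_zero O (hB.ne_zero j))) := by
    intro i
    obtain ⟨q, hq⟩ : nb i ∣ N := Finset.dvd_prod_of_mem _ (Finset.mem_univ i)
    rw [hq, pow_mul]
    exact Subgroup.pow_mem _ (hnbmem i) q
  -- the monomials `x^{eᵢ}` of value `bᵢ^N`
  choose e he using fun i => exists_lmonomial_of_mem_closure O x hB.ne_zero (hbN i)
  have hbM : ∀ i, b i ∈ M := fun i => Submonoid.subset_closure ⟨i, rfl⟩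
  have heval : ∀ i, ValMem O M ((e i).prod fun j (n : ℤ) => x j ^ n) := fun i =>
    ⟨b i ^ N, pow_mem (hbM i) N, he i⟩
  refine ⟨e, heval, ?_⟩
  set C₀ : Subalgebra k L := Algebra.adjoin k ((Set.range fun i => (y i : L)) ∪
    (Set.range fun i => (y i : L)⁻¹) ∪ Set.range fun i => (e i).prod fun j (n : ℤ) => x j ^ n) with hC₀
  -- `C₀ ≤ k[M_B]`
  have hC₀le : C₀ ≤ toricChart (k := k) O x y M := by
    refine Algebra.adjoin_le ?_
    rintro m ((⟨i, rfl⟩ | ⟨i, rfl⟩) | ⟨i, rfl⟩)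
    · exact coe_mem_toricChart x y M i
    · exact inv_coe_mem_toricChart x y M i
    · exact lmonomial_mem_toricChart x y (e i) (heval i)
  refine le_antisymm (nrAlg_le_nrAlg_of_le_nrAlg (Algebra.adjoin_le ?_)) (nrAlg_mono hC₀le)
  -- every generator of `k[M_B]` is integral over `C₀`
  rintro m ((⟨i, rfl⟩ | ⟨i, rfl⟩) | ⟨⟨γ, hγM, hγ⟩, d, rfl⟩)
  · exact le_nrAlg _ (Algebra.subset_adjoin (Or.inl (Or.inl ⟨i, rfl⟩)))
  · exact le_nrAlg _ (Algebra.subset_adjoin (Or.inl (Or.inr ⟨i, rfl⟩)))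
  · -- `|x^d| = ∏ bᵢ^{cᵢ}`, so `N d = ∑ cᵢ eᵢ` and `(x^d)^N = ∏ (x^{eᵢ})^{cᵢ} ∈ C₀`
    obtain ⟨c, hc⟩ := Submonoid.mem_closure_range_iff.mp hγM
    have hsum : N • d = c.sum fun i m => m • e i := by
      apply valuation_lmonomial_injective O x hB.ne_zero hB.linearIndependent
      change O.valuation ((N • d).prod fun j (n : ℤ) => x j ^ n) =
        O.valuation ((c.sum fun i m => m • e i).prod fun j (n : ℤ) => x j ^ n)
      rw [lmonomial_nsmul x hB.ne_zero, map_pow, ← hγ, hc, Finsupp.sum,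
        lmonomial_sum x hB.ne_zero, map_prod, Finsupp.prod, Units.coe_prod, ← Finset.prod_pow]
      refine Finset.prod_congr rfl fun i _ => ?_
      rw [lmonomial_nsmul x hB.ne_zero, map_pow, Units.val_pow_eq_pow_val, ← pow_mul, mul_comm,
        pow_mul, ← Units.val_pow_eq_pow_val, he i]
    refine mem_nrAlg_of_pow_mem hN ?_
    rw [← lmonomial_nsmul x hB.ne_zero, hsum, Finsupp.sum, lmonomial_sum x hB.ne_zero]
    refine prod_mem fun i _ => ?_
    rw [lmonomial_nsmul x hB.ne_zero]
    have hmem : ((e i).prod fun j (n : ℤ) => x j ^ n) ∈ C₀ :=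
      Algebra.subset_adjoin (Or.inr ⟨i, rfl⟩)
    exact C₀.pow_mem hmem _

end Subchart

end Literature.AlgebraicGeometry.Resolution

end
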